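import Mathlib
import Literature.AlgebraicGeometry.Resolution.CobordantChartCoefficients
import Literature.AlgebraicGeometry.Resolution.AxisPolyhedron
import Summits.ResolutionOfSingularities.ResolutionOfSingularities.Theorems.WeightedInvariantLocalWeightedDropAxisPreparationAux
import Summits.ResolutionOfSingularities.ResolutionOfSingularities.Theorems.WeightedInvariantLocalWeightedDropAxisPreparationTaylor
import Summits.ResolutionOfSingularities.ResolutionOfSingularities.Theorems.WeightedInvariantLocalWeightedDropAxisWeightedMoveCone

/-!
# Helpers for the axis preparation, III: a solving vector witnesses its level; one shear step

Crux `LocalWeightedDrop` (stmt-ResolutionOfSingularities-8899, route ResolutionOfSingularities/WeightedInvariant),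
line `hasse-ridge-face-selection`, registered stub `stub_axisPreparation` (B1).  Vocabulary of
`Literature/…/AxisPolyhedron.lean` (`Solvable d M lam g`: `δ ≥ M` and the coefficients of `g` on the line
`c = M (d - |a|)`, `|a| < d`, are those of `F(X' + lam Z^M)`; `shearFam`; `TrivialApexX`; `AxisCone`) and the
Taylor-polynomial calculus of `…AxisPreparationTaylor`.

* `exists_coeff_ne_zero_of_solvable` — A SOLVING VECTOR WITNESSES ITS LEVEL: if `lam ≠ 0` solves the vertex at the
  level `M` and the degree-`d` form has trivial apex inside `z = 0`, some coefficient of `g` on the line of level `M`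
  is non-zero (else `F(X' + lam) = F(X')` as polynomials; evaluate on `z = 0`); hence `2 ≤ M` when `g` has order `d`
  and its degree-`d` part involves no `z` (`two_le_of_solvable`);
* `coeff_subst_shearFam_eq_zero_of_solvable` — THE SHEAR STEP: if `lam` solves the vertex at the level `M ≥ 1`, the
  shear `x' ↦ x' - lam z^M` kills every coefficient `x'^a z^c`, `|a| < d`, `c ≤ M (d - |a|)` (in weight `≤ M d` for
  `(M, …, M, 1)` the series agrees with the Taylor polynomial, whose shear is `F(X')`; the rest has weight `> M d`).
-/

set_option linter.dupNamespace false -- mandated namespace of this single-conjunct summit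

namespace Summit.ResolutionOfSingularities.ResolutionOfSingularities.Theorems

open Literature.AlgebraicGeometry.Resolution

namespace AxisPreparation

open MvPowerSeries AxisPolyhedron

variable {k : Type} [Field k] {n : ℕ}

/-! ### A solving vector witnesses its level -/

/-- A SOLVING VECTOR WITNESSES ITS LEVEL.  If `lam ≠ 0` solves the vertex of `g` at the integer level `M` and the
degree-`d` form of `g` has trivial apex inside `z = 0`, then `g` has a NON-ZERO coefficient on the line
`c = M (d - |a|)`, `|a| < d`: otherwise every Hasse–Taylor coefficient below `x'`-degree `d` vanishes,
`F(X' + lam) = F(X')` as polynomials, and evaluating on `z = 0` makes `lam` a translation-invariance vector of the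
form. -/
theorem exists_coeff_ne_zero_of_solvable {d M : ℕ} {g : MvPowerSeries (Fin (n + 1)) k} {lam : Fin n → k}
    (hapex : TrivialApexX d g) (hlam : lam ≠ 0) (hsol : Solvable d M lam g) :
    ∃ E : Fin (n + 1) →₀ ℕ, xDeg E < d ∧ E (Fin.last n) = M * (d - xDeg E) ∧ coeff E g ≠ 0 := by
  classical
  obtain ⟨-, hline⟩ : AboveLevel d M 1 g ∧ _ := hsol
  by_contra hnone
  push Not at hnone
  -- every Hasse–Taylor coefficient below `x'`-degree `d` vanishes
  have htc : ∀ E : Fin (n + 1) →₀ ℕ, xDeg E < d → taylorCoeff d g lam E = 0 := by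
    intro E hE
    obtain ⟨E', hE'x, hE'l⟩ : ∃ E' : Fin (n + 1) →₀ ℕ, (∀ j : Fin n, E (Fin.castSucc j) = E' (Fin.castSucc j)) ∧
        E' (Fin.last n) = M * (d - xDeg E) :=
      ⟨E.update (Fin.last n) (M * (d - xDeg E)),
        fun j => by rw [Finsupp.coe_update, Function.update_of_ne (Fin.castSucc_lt_last j).ne],
        by rw [Finsupp.coe_update, Function.update_self]⟩
    have hxE' : xDeg E' = xDeg E := Finset.sum_congr rfl fun j _ => (hE'x j).symm
    have h1 : xDeg E' < d := by rw [hxE']; exact hE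
    have h2 : E' (Fin.last n) = M * (d - xDeg E') := by rw [hE'l, hxE']
    rw [taylorCoeff_congr hE'x, ← hline E' h1 h2]
    exact hnone E' h1 h2
  -- hence `F(X' + lam) = F(X')` as polynomials
  have hpoly : (∑ B ∈ ((Finset.univ : Finset (Fin (n + 1))).finsuppAntidiag d).filter
      (fun B => B (Fin.last n) = 0),
      MvPolynomial.C (coeff B g) * ∏ j : Fin n, (MvPolynomial.X (Fin.castSucc j) +
        MvPolynomial.C (lam j) * MvPolynomial.X (Fin.last n) ^ 0 : MvPolynomial (Fin (n + 1)) k) ^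
          (B (Fin.castSucc j))) =
      ∑ B ∈ ((Finset.univ : Finset (Fin (n + 1))).finsuppAntidiag d).filter (fun B => B (Fin.last n) = 0),
        MvPolynomial.monomial B (coeff B g) := by
    refine MvPolynomial.ext _ _ fun E => ?_
    rw [coeff_taylorPoly, zero_mul, MvPolynomial.coeff_sum]
    simp_rw [MvPolynomial.coeff_monomial]
    rw [Finset.sum_ite_eq']
    by_cases h0 : E (Fin.last n) = 0
    · rw [if_pos h0]
      rcases lt_trichotomy (xDeg E) d with hlt | heq | hgt
      · rw [htc E hlt, if_neg]
        intro hmem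
        have := xDeg_eq_of_mem_axisExps hmem
        omega
      · have hmem : E ∈ ((Finset.univ : Finset (Fin (n + 1))).finsuppAntidiag d).filter
            (fun B => B (Fin.last n) = 0) := by
          rw [mem_axisExps, degree_eq_xDeg_add, heq, h0]
          exact ⟨add_zero d, rfl⟩
        rw [taylorCoeff_of_mem_axisExps g lam hmem, if_pos hmem]
      · rw [taylorCoeff_eq_zero_of_lt g lam hgt, if_neg]
        intro hmem
        have := xDeg_eq_of_mem_axisExps hmem
        omega
    · rw [if_neg h0, if_neg]
      intro hmem
      exact h0 (mem_axisExps.mp hmem).2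
  -- evaluate on `z = 0`: `F(v + lam) = F(v)` for every `v`
  have heval : ∀ v : Fin n → k,
      CobordantChart.initEval (fun _ : Fin (n + 1) => 1) (Fin.snoc (v + lam) 0 : Fin (n + 1) → k) d g =
        CobordantChart.initEval (fun _ : Fin (n + 1) => 1) (Fin.snoc v 0 : Fin (n + 1) → k) d g := by
    intro v
    have h := congrArg (MvPolynomial.eval (Fin.snoc v 0 : Fin (n + 1) → k)) hpoly
    rw [map_sum, map_sum] at h
    rw [initEval_snoc_zero, initEval_snoc_zero]
    convert h using 1
    · refine Finset.sum_congr rfl fun B _ => ?_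
      rw [map_mul, MvPolynomial.eval_C, map_prod]
      refine congrArg _ (Finset.prod_congr rfl fun j _ => ?_)
      rw [map_pow, map_add, map_mul, MvPolynomial.eval_C, map_pow, MvPolynomial.eval_X, MvPolynomial.eval_X,
        Fin.snoc_castSucc, pow_zero, mul_one, Pi.add_apply]
    · refine Finset.sum_congr rfl fun B hB => ?_
      rw [MvPolynomial.eval_monomial, Finsupp.prod_pow, Fin.prod_univ_castSucc, Fin.snoc_last,
        (mem_axisExps.mp hB).2, pow_zero, mul_one]
      simp only [Fin.snoc_castSucc]
  obtain ⟨v, hv⟩ := hapex lam hlam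
  exact hv (by rw [AxisWeightedMove.snoc_add_snoc, heval])

/-- … AND THE LEVEL IS AT LEAST `2`: the lines of the levels `0` and `1` carry no coefficient of `g` (order `d`, resp.
the degree-`d` part involves no `z`). -/
theorem two_le_of_solvable {d M : ℕ} {g : MvPowerSeries (Fin (n + 1)) k} {lam : Fin n → k}
    (hgd : g.order = d) (hcone : AxisCone d g) (hapex : TrivialApexX d g) (hlam : lam ≠ 0)
    (hsol : Solvable d M lam g) : 2 ≤ M := by
  obtain ⟨E, hEx, hEl, hEg⟩ := exists_coeff_ne_zero_of_solvable hapex hlam hsol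
  have hdeg := degree_eq_xDeg_add E
  by_contra hM
  push Not at hM
  interval_cases M
  · -- level `0`: degree `< d`
    rw [zero_mul] at hEl
    refine hEg (MvPowerSeries.coeff_of_lt_order ?_)
    rw [hgd]
    exact_mod_cast (show E.degree < d by omega)
  · -- level `1`: degree `d` with a `z`
    rw [one_mul] at hEl
    exact hEg (hcone E (by omega) (by omega))

/-! ### One shear step -/

/-- THE SHEAR STEP.  If `lam` solves the vertex of `g` at the level `M ≥ 1`, then after the shear
`x' ↦ x' - lam z^M` every coefficient `x'^a z^c` with `|a| < d` and `c ≤ M (d - |a|)` vanishes (the polyhedron moves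
strictly beyond `M`).  Proof: in weight `≤ M d` for the weights `(M, …, M, 1)` the series `g` agrees with the Taylor
polynomial `F(X' + lam Z^M)`, whose shear is `F(X')` (`x'`-degree `d`); the rest of `g` has weight `> M d`, and so has
its shear (`coeff_subst_eq_zero_of_weight_lt`). -/
theorem coeff_subst_shearFam_eq_zero_of_solvable {d M : ℕ} {g : MvPowerSeries (Fin (n + 1)) k}
    {lam : Fin n → k} (hM : 1 ≤ M) (hsol : Solvable d M lam g) {E : Fin (n + 1) →₀ ℕ} (hEx : xDeg E < d)
    (hEl : E (Fin.last n) ≤ M * (d - xDeg E)) :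
    coeff E (subst (shearFam fun j => C (lam j) * X (Fin.last n) ^ M) g) = 0 := by
  classical
  obtain ⟨habove, hline⟩ : AboveLevel d M 1 g ∧ _ := hsol
  obtain ⟨T, hT⟩ : ∃ T : MvPolynomial (Fin (n + 1)) k,
      T = ∑ B ∈ ((Finset.univ : Finset (Fin (n + 1))).finsuppAntidiag d).filter (fun B => B (Fin.last n) = 0),
        MvPolynomial.C (coeff B g) * ∏ j : Fin n, (MvPolynomial.X (Fin.castSucc j) +
          MvPolynomial.C (lam j) * MvPolynomial.X (Fin.last n) ^ M : MvPolynomial (Fin (n + 1)) k) ^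
            (B (Fin.castSucc j)) := ⟨_, rfl⟩
  have hMne : M ≠ 0 := by omega
  have h0 : ∀ j : Fin n, constantCoeff (C (lam j) * X (Fin.last n) ^ M : MvPowerSeries (Fin (n + 1)) k) = 0 :=
    fun j => constantCoeff_C_mul_X_pow (lam j) hMne
  -- (1) `g` agrees with the Taylor polynomial in weight `≤ M d`
  have hagree : ∀ B : Fin (n + 1) →₀ ℕ,
      Finsupp.weight (Fin.snoc (fun _ : Fin n => M) 1 : Fin (n + 1) → ℕ) B < M * d + 1 →
        coeff B (g - (T : MvPowerSeries (Fin (n + 1)) k)) = 0 := by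
    intro B hB
    rw [weight_snoc] at hB
    rw [map_sub, MvPolynomial.coeff_coe, hT, coeff_taylorPoly, sub_eq_zero]
    have hBx : xDeg B ≤ d := by
      by_contra h
      push Not at h
      have : M * (d + 1) ≤ M * xDeg B := Nat.mul_le_mul_left M h
      rw [mul_add, mul_one] at this
      omega
    rcases hBx.eq_or_lt with hBd | hBd
    · -- `|b| = d`: `c = 0`, top-degree Hasse–Taylor coefficient
      have hBl : B (Fin.last n) = 0 := by
        rw [hBd] at hB
        omega
      have hmem : B ∈ ((Finset.univ : Finset (Fin (n + 1))).finsuppAntidiag d).filter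
          (fun B => B (Fin.last n) = 0) := by
        rw [mem_axisExps, degree_eq_xDeg_add, hBd, hBl]
        exact ⟨add_zero d, rfl⟩
      rw [if_pos (by rw [hBl, hBd, Nat.sub_self, mul_zero]), taylorCoeff_of_mem_axisExps g lam hmem]
    · by_cases hl : B (Fin.last n) = M * (d - xDeg B)
      · rw [if_pos hl, hline B hBd hl]
      · rw [if_neg hl]
        refine habove B hBd ?_
        rw [one_mul]
        have : B (Fin.last n) ≤ M * (d - xDeg B) := (weight_le_iff hBx).mp (by omega)
        omega
  -- (2) the shear of the Taylor polynomial is `F(X')`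
  have hshearT : subst (shearFam fun j => C (lam j) * X (Fin.last n) ^ M) (T : MvPowerSeries (Fin (n + 1)) k) =
      ∑ B ∈ ((Finset.univ : Finset (Fin (n + 1))).finsuppAntidiag d).filter (fun B => B (Fin.last n) = 0),
        MvPowerSeries.monomial B (coeff B g) := by
    rw [subst_coe, hT, map_sum]
    refine Finset.sum_congr rfl fun B hB => ?_
    have hfac : ∀ j : Fin n, MvPolynomial.aeval (shearFam fun j => C (lam j) * X (Fin.last n) ^ M)
        ((MvPolynomial.X (Fin.castSucc j) + MvPolynomial.C (lam j) * MvPolynomial.X (Fin.last n) ^ M :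
          MvPolynomial (Fin (n + 1)) k) ^ (B (Fin.castSucc j))) =
        (X (Fin.castSucc j) : MvPowerSeries (Fin (n + 1)) k) ^ (B (Fin.castSucc j)) := by
      intro j
      rw [map_pow, map_add, map_mul, MvPolynomial.aeval_C, map_pow, MvPolynomial.aeval_X, MvPolynomial.aeval_X,
        shearFam_castSucc, shearFam_last, ← c_eq_algebraMap]
      congr 1
      change X (Fin.castSucc j) - C (lam j) * X (Fin.last n) ^ M + C (lam j) * X (Fin.last n) ^ M = _
      rw [sub_add_cancel]
    rw [map_mul, MvPolynomial.aeval_C, map_prod, ← c_eq_algebraMap]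
    simp_rw [hfac]
    rw [MvPowerSeries.monomial_eq', Finsupp.prod_pow, Fin.prod_univ_castSucc, (mem_axisExps.mp hB).2, pow_zero,
      mul_one]
  -- (3) assemble
  have hwE : Finsupp.weight (Fin.snoc (fun _ : Fin n => M) 1 : Fin (n + 1) → ℕ) E < M * d + 1 := by
    rw [weight_snoc]
    have := (weight_le_iff hEx.le).mpr hEl
    omega
  have hsplit : g = (T : MvPowerSeries (Fin (n + 1)) k) + (g - T) := by ring
  rw [hsplit, subst_add (hasSubst_shearFam h0), map_add, hshearT,
    coeff_subst_eq_zero_of_weight_lt _ (constantCoeff_shearFam h0) (weight_le_weightedOrder_shearFam_monomial lam M)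
      hagree E hwE, add_zero, map_sum]
  simp_rw [MvPowerSeries.coeff_monomial]
  rw [Finset.sum_ite_eq, if_neg]
  intro hmem
  have := xDeg_eq_of_mem_axisExps hmem
  omega

end AxisPreparation

end Summit.ResolutionOfSingularities.ResolutionOfSingularities.Theorems
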